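import Mathlib
import HarnessLib
import HarnessLib.Audit
import Summits.PneNP.PneNP.Theses.SymmetryBudget
import Literature.Computability.Complexity.SymmetricCircuit
import Literature.Computability.Complexity.GraphCanonization
import Summits.PneNP.PneNP.Theorems.SymmetryBudgetWindowBarrierStubHeaderHardwiring
import Summits.PneNP.PneNP.Theorems.SymmetryBudgetWindowBarrierStubAddressableBitLanguage

/-!
# Line `canonical-form-completeness` — crux `SymmetryBudget.WindowBarrier` (stmt-PneNP-2145)

Crux (fixed, route `route-PneNP-SymmetryBudget`, rank 4): there is `L ∈ P` whose graph slices
`x ↦ [encode ⟨m, Gr x⟩ ∈ L]` are `Bud(m,⌊log₂ m⌋)`-invariant and, for every polynomial `p`, infinitely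
often have no `Bud(m,⌊log₂ m⌋)`-symmetric threshold circuit of size `≤ p(m)`.

Idea (crux idea card `canonical-form-completeness`, triage r1 pass): COMPLETENESS OF CANONICAL FORMS.
A polynomial-time complete invariant `F` for `Bud`-isomorphism of `m`-vertex graphs exists
(Babai–Luks 1983: canonical labelling of vertex-coloured graphs in `exp(O(√(g log g)))`, here
`g = ⌊log₂ m⌋`, so `m^{o(1)}`); turning its output into ONE bit language `L_F ∈ P` by reading a bit
ADDRESS off the first `t(m) = O(log m)` ORDERED ("header") vertices makes `L_F` separate EVERY pair of
non-`Bud`-isomorphic inputs that agree on the header, after a suitable header rewrite. Consequently the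
`∃ L ∈ P` half of the crux is discharged once and for all, and the crux TRANSFERS to a purely
combinatorial statement with no Turing machines in it:

  SI (symmetric indistinguishability, `stub_symmetricIndistinguishability`): for every polynomial `p`,
  infinitely often there are two non-`Bud(m,⌊log₂ m⌋)`-isomorphic inputs on which EVERY `Bud`-symmetric
  threshold circuit of size `≤ p(m)` agrees.

`SI ⇒ WindowBarrier` is the kernel-checked composition below (`windowBarrier_restated`, then
`WindowBarrier_of` by definitional unfolding of the route's inline `Sym/HasSym/Bud/Gr`, which are
verbatim `Circuit.IsSymmetricUnder` / `HasSymCircuit tcBasis` / `pointStabiliserBudget` of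
`Literature/Computability/Complexity/SymmetricCircuit.lean`).

Stubs (registered by `ledger skeleton check`; statements are self-contained over existing decls):
* `stub_canonicalFormFTIME`         — S1a, Babai–Luks canonical forms of coloured graphs, FTIME(2^{O(√N)}) (known theorem = literature debt).
* `stub_completeInvariantFP_of_canonicalForm` — S1b, canonical form of the rank-coloured free part ⇒ complete invariant in `FP` (provable now, FP plumbing).
  (`completeInvariantFP` = S1b S1a is now DERIVED — no longer a stub.)
* `stub_addressableBitLanguage`     — S2, header addressing: complete invariant in `FP` ⇒ separating bit language in `P` (provable now).
* `stub_headerHardwiring`           — S3, symmetric circuits are closed under hard-wiring constants into `Γ`-fixed inputs, size `+ 2` (provable now).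
* `stub_symmetricIndistinguishability` — S4, the fooling pairs (OPEN; the hardest stub; where idea 1's block game / EST would be spent).

Vocabulary used inline (no new definitions): `Gr x := SimpleGraph.fromRel fun u v => x (u, v) = true`
(the route's decoding of an `m × m` Boolean matrix), `Bud := pointStabiliserBudget m (Nat.log 2 m)`,
`BudIso x y := ∃ ρ ∈ Bud, Gr (x ∘ (ρ × ρ)) = Gr y`, header overwrite
`ovw t h x := fun q => if q.1 < t ∧ q.2 < t then h q else x q`.
-/

-- `Summit.PneNP.PneNP.…` duplicates `PneNP` BY DESIGN (single-problem summit, D-0017).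
set_option linter.dupNamespace false

namespace Summit.PneNP.PneNP.Cruxes.WindowBarrier.CanonicalFormCompleteness

open Literature.Computability.Complexity Filter
open scoped Classical

/-! ## The four stubs -/

/-- **S1a — canonical forms of vertex-coloured graphs in moderately exponential time
(Babai–Luks 1983; KNOWN theorem, literature debt).** Verbatim the body of the named fact
`Literature.Computability.Complexity.babaiLuks1983_canonicalForm` (proposed to
`Literature/Computability/Complexity/GraphCanonization.lean`; inlined here over tree codes so
that the stub is self-contained): there are `c` and a string map `can ∈ FTIME(N ↦ 2^{c√N})`
which on the code `⟨encodingGraph.encode ⟨k,G⟩, [col 0,…,col (k-1)]⟩` of a vertex-coloured graph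
returns the code of a colour-isomorphic coloured graph on `Fin k` and takes equal values on codes
of colour-isomorphic coloured graphs. The input-length form `2^{O(√N)}` is implied by the paper's
`poly(N)·exp(C√(k log k))` since the code contains the `k × k` adjacency matrix (`N ≥ k²`); a
combinatorial `c^k` canoniser (Corneil–Goldberg 1984) implies it as well. Discharged only by
formalising such a canoniser (XL); until then the skeleton is closed MODULO this stub.
Source: Babai–Luks, STOC 1983, doi:10.1145/800061.808746, Abstract and §4. -/
theorem stub_canonicalFormFTIME :
    ∃ c : ℕ, ∃ can ∈ FTIME (fun N => 2 ^ (c * Nat.sqrt N)),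
      (∀ (k : ℕ) (G : SimpleGraph (Fin k)) (col : Fin k → ℕ),
          ∃ (G' : SimpleGraph (Fin k)) (col' : Fin k → ℕ),
            can (boolPair (encodingGraph.encode ⟨k, G⟩)
                  ((encodingFinVec Computability.encodingNatBool k).encode col)) =
                boolPair (encodingGraph.encode ⟨k, G'⟩)
                  ((encodingFinVec Computability.encodingNatBool k).encode col') ∧
              ∃ σ : G ≃g G', ∀ v : Fin k, col' (σ v) = col v) ∧
      ∀ (k : ℕ) (G₁ : SimpleGraph (Fin k)) (c₁ : Fin k → ℕ) (G₂ : SimpleGraph (Fin k))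
        (c₂ : Fin k → ℕ), (∃ σ : G₁ ≃g G₂, ∀ v : Fin k, c₂ (σ v) = c₁ v) →
          can (boolPair (encodingGraph.encode ⟨k, G₁⟩)
                ((encodingFinVec Computability.encodingNatBool k).encode c₁)) =
            can (boolPair (encodingGraph.encode ⟨k, G₂⟩)
                ((encodingFinVec Computability.encodingNatBool k).encode c₂)) := by
  -- LITERATURE DEBT: this is `Literature.Computability.Complexity.babaiLuks1983_canonicalForm`
  -- (landed p74928, `Literature/Computability/Complexity/GraphCanonization.lean`) unfolded — see
  -- `stub_canonicalFormFTIME_iff` below; it closes by `exact babaiLuks1983_canonicalForm_holds` once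
  -- that discharge exists (XL formalisation of a moderately exponential canoniser).
  sorry

/-- S1a IS the tree's named fact `babaiLuks1983_canonicalForm` (definitional unfolding). -/
theorem stub_canonicalFormFTIME_iff :
    babaiLuks1983_canonicalForm ↔
    ∃ c : ℕ, ∃ can ∈ FTIME (fun N => 2 ^ (c * Nat.sqrt N)),
      (∀ (k : ℕ) (G : SimpleGraph (Fin k)) (col : Fin k → ℕ),
          ∃ (G' : SimpleGraph (Fin k)) (col' : Fin k → ℕ),
            can (boolPair (encodingGraph.encode ⟨k, G⟩)
                  ((encodingFinVec Computability.encodingNatBool k).encode col)) =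
                boolPair (encodingGraph.encode ⟨k, G'⟩)
                  ((encodingFinVec Computability.encodingNatBool k).encode col') ∧
              ∃ σ : G ≃g G', ∀ v : Fin k, col' (σ v) = col v) ∧
      ∀ (k : ℕ) (G₁ : SimpleGraph (Fin k)) (c₁ : Fin k → ℕ) (G₂ : SimpleGraph (Fin k))
        (c₂ : Fin k → ℕ), (∃ σ : G₁ ≃g G₂, ∀ v : Fin k, c₂ (σ v) = c₁ v) →
          can (boolPair (encodingGraph.encode ⟨k, G₁⟩)
                ((encodingFinVec Computability.encodingNatBool k).encode c₁)) =
            can (boolPair (encodingGraph.encode ⟨k, G₂⟩)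
                ((encodingFinVec Computability.encodingNatBool k).encode c₂)) :=
  Iff.rfl

/-- **S1b — from canonical forms of small coloured graphs to a polynomial-time complete
invariant for `Bud`-isomorphism (provable now; FP plumbing + a padding-type composition).**
Given `can` as in S1a, the witness is `F(code ⟨m, Gr x⟩) := ⟨⟨fixed data, attachment dictionary⟩,
can (code of the rank-coloured free graph)⟩` where, with `g = ⌊log₂ m⌋`, `n = m - g`, free
vertices `n … m-1`: `att(v) ∈ {0,1}^n` is the row of `v` restricted to the ordered vertices,
`rank(v) = #{u free : att(u) <_num att(v)}` (a canonical injective renaming of the occurring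
attachment vectors by numbers `< g`), the free graph is `Gr x` induced on the free vertices
relabelled `j ↦ n + j`, the fixed data is the code with all free rows/columns cleared, and the
dictionary lists for `r < g` the attachment vector of rank `r` (empty if none). Correctness:
`F x = F y` iff fixed data agree, dictionaries agree and (S1a, completeness of a canonical
form: `can X = can Y ↔ X ≅_col Y`, codes being injective) the rank-coloured free graphs are
colour-isomorphic by some `σ`, which then preserves `att` (dictionary) and extends by the
identity to `ρ ∈ Bud(m,g)` with `Gr (x ∘ ρ×ρ) = Gr y`; conversely a `ρ ∈ Bud` restricts to such
a `σ`. Complexity: the extraction is in `FP` with output length `O(g²) = O(log² |w|)`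
(`≤ (D log₂|w| + D)²`), so `can` costs `2^{c (D log₂|w| + D)} = 2^{cD} |w|^{cD}` steps on it
(`TimeComputable.comp_holds`, cf. `preimage_mem_P_of_mem_E`), and re-pairing is `FP`.
Size: L (FP bricks: segment extraction, counted loops, numeric comparison; ≈ 800–1200 lines,
to be landed as 2–3 brick files). Source: this line; Arora–Barak 2009 §1.3 (composition). -/
theorem stub_completeInvariantFP_of_canonicalForm :
    (∃ c : ℕ, ∃ can ∈ FTIME (fun N => 2 ^ (c * Nat.sqrt N)),
      (∀ (k : ℕ) (G : SimpleGraph (Fin k)) (col : Fin k → ℕ),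
          ∃ (G' : SimpleGraph (Fin k)) (col' : Fin k → ℕ),
            can (boolPair (encodingGraph.encode ⟨k, G⟩)
                  ((encodingFinVec Computability.encodingNatBool k).encode col)) =
                boolPair (encodingGraph.encode ⟨k, G'⟩)
                  ((encodingFinVec Computability.encodingNatBool k).encode col') ∧
              ∃ σ : G ≃g G', ∀ v : Fin k, col' (σ v) = col v) ∧
      ∀ (k : ℕ) (G₁ : SimpleGraph (Fin k)) (c₁ : Fin k → ℕ) (G₂ : SimpleGraph (Fin k))
        (c₂ : Fin k → ℕ), (∃ σ : G₁ ≃g G₂, ∀ v : Fin k, c₂ (σ v) = c₁ v) →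
          can (boolPair (encodingGraph.encode ⟨k, G₁⟩)
                ((encodingFinVec Computability.encodingNatBool k).encode c₁)) =
            can (boolPair (encodingGraph.encode ⟨k, G₂⟩)
                ((encodingFinVec Computability.encodingNatBool k).encode c₂))) →
    ∃ F ∈ FP, ∃ m₀ : ℕ, ∀ m : ℕ, m₀ ≤ m → ∀ x y : Fin m × Fin m → Bool,
      (F (encodingGraph.encode ⟨m, SimpleGraph.fromRel fun u v => x (u, v) = true⟩) =
          F (encodingGraph.encode ⟨m, SimpleGraph.fromRel fun u v => y (u, v) = true⟩) ↔
        ∃ ρ ∈ pointStabiliserBudget m (Nat.log 2 m),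
          (SimpleGraph.fromRel fun u v => x (ρ u, ρ v) = true) =
            (SimpleGraph.fromRel fun u v => y (u, v) = true)) := by
  sorry

/-- **S1 — a polynomial-time complete invariant for `Bud`-isomorphism** (derived: S1b applied
to S1a; no `sorry` of its own). There is `F ∈ FP` such that, for all large `m` and all `m × m`
Boolean matrices `x, y`, `F` takes the same value on the codes of `Gr x`, `Gr y` iff some
`ρ ∈ Bud(m,⌊log₂ m⌋)` carries `Gr x` onto `Gr y`. [Babai–Luks 1983 + this line] -/
theorem completeInvariantFP :
    ∃ F ∈ FP, ∃ m₀ : ℕ, ∀ m : ℕ, m₀ ≤ m → ∀ x y : Fin m × Fin m → Bool,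
      (F (encodingGraph.encode ⟨m, SimpleGraph.fromRel fun u v => x (u, v) = true⟩) =
          F (encodingGraph.encode ⟨m, SimpleGraph.fromRel fun u v => y (u, v) = true⟩) ↔
        ∃ ρ ∈ pointStabiliserBudget m (Nat.log 2 m),
          (SimpleGraph.fromRel fun u v => x (ρ u, ρ v) = true) =
            (SimpleGraph.fromRel fun u v => y (u, v) = true)) :=
  stub_completeInvariantFP_of_canonicalForm stub_canonicalFormFTIME

/-- **S2 — header addressing: a complete invariant in `FP` yields ONE separating bit language in `P`.**
Given `F` as in S1, there are `L ∈ P`, a header size `t : ℕ → ℕ` and a threshold `m₁` such that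
(i) every `m`-slice of `L` is `Bud(m,⌊log₂ m⌋)`-invariant (for ALL `m`; slices below `m₁` are made
constant), (ii) `t m + ⌊log₂ m⌋ ≤ m` for `m ≥ m₁` (so `Bud` fixes the header vertices `0 … t m - 1`),
(iii) for `m ≥ m₁`, any two matrices that agree on the header block and give non-`Bud`-isomorphic
graphs are separated by `L` after overwriting the header block of both with one suitable `h`.
Intended witness: `⟨m, G⟩ ∈ L` iff `m ≥ m₁` and the query `(type, a)` read off the header edges
`{0, k}` of `G` answers yes on `u := F (encode ⟨m, G with all header edges deleted⟩)`
(`type 0`: `a < |u|`; `type 1`: `a < |u| ∧ u[a] = 1`); `t m = O(log m)` because `|u| ≤ poly(m)`.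
Separation: header-agreeing non-iso pairs stay non-iso after clearing the header, so the two `u`'s
differ (S1, ⇒), at a length or at a bit, which one query exposes; invariance: `ρ ∈ Bud` fixes the header
pointwise and commutes with clearing, and `F` is an invariant (S1, ⇐). Membership in `P`: decoding,
clearing, `F ∈ FP`, address extraction — the tree's `FP`/`P` closure lemmas (`preimage_mem_P`, …).
Routine but unwritten (M–L). Source: this line; standard padding/addressing, Arora–Barak 2009 §1–2. -/
theorem stub_addressableBitLanguage :
    ∀ F ∈ FP, ∀ m₀ : ℕ,
      (∀ m : ℕ, m₀ ≤ m → ∀ x y : Fin m × Fin m → Bool,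
        (F (encodingGraph.encode ⟨m, SimpleGraph.fromRel fun u v => x (u, v) = true⟩) =
            F (encodingGraph.encode ⟨m, SimpleGraph.fromRel fun u v => y (u, v) = true⟩) ↔
          ∃ ρ ∈ pointStabiliserBudget m (Nat.log 2 m),
            (SimpleGraph.fromRel fun u v => x (ρ u, ρ v) = true) =
              (SimpleGraph.fromRel fun u v => y (u, v) = true))) →
      ∃ L ∈ Classes.P, ∃ t : ℕ → ℕ, ∃ m₁ : ℕ,
        (∀ m : ℕ, ∀ ρ ∈ pointStabiliserBudget m (Nat.log 2 m), ∀ x : Fin m × Fin m → Bool,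
          encodingGraph.encode ⟨m, SimpleGraph.fromRel fun u v => x (ρ u, ρ v) = true⟩ ∈ L ↔
            encodingGraph.encode ⟨m, SimpleGraph.fromRel fun u v => x (u, v) = true⟩ ∈ L) ∧
        (∀ m : ℕ, m₁ ≤ m → t m + Nat.log 2 m ≤ m) ∧
        (∀ m : ℕ, m₁ ≤ m → ∀ x y : Fin m × Fin m → Bool,
          (∀ q : Fin m × Fin m, (q.1 : ℕ) < t m → (q.2 : ℕ) < t m → x q = y q) →
          (¬ ∃ ρ ∈ pointStabiliserBudget m (Nat.log 2 m),
              (SimpleGraph.fromRel fun u v => x (ρ u, ρ v) = true) =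
                (SimpleGraph.fromRel fun u v => y (u, v) = true)) →
          ∃ h : Fin m × Fin m → Bool,
            ¬ (encodingGraph.encode ⟨m, SimpleGraph.fromRel fun u v =>
                    (if (u : ℕ) < t m ∧ (v : ℕ) < t m then h (u, v) else x (u, v)) = true⟩ ∈ L ↔
                encodingGraph.encode ⟨m, SimpleGraph.fromRel fun u v =>
                    (if (u : ℕ) < t m ∧ (v : ℕ) < t m then h (u, v) else y (u, v)) = true⟩ ∈ L)) :=
  -- LANDED (wave 1, p76488; bricks p75231): `Summits/PneNP/PneNP/Theorems/SymmetryBudgetWindowBarrierStubAddressableBitLanguage.lean`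
  _root_.Summit.PneNP.PneNP.Theorems.stub_addressableBitLanguage

/-- **S3 — symmetric circuits are closed under hard-wiring constants into `Γ`-fixed inputs.**
If some `Γ`-symmetric `tcBasis`-circuit of size `≤ s` computes `f`, and every `ρ ∈ Γ` fixes the
header coordinates `< t` pointwise, then for every constant header block `h` some `Γ`-symmetric
`tcBasis`-circuit of size `≤ s + 2` computes `x ↦ f (x with its header block overwritten by h)`.
Construction: prepend the two constant gates `∧₀ = 1`, `∨₀ = 0` (both in `acBasis ⊆ tcBasis`), shift
every back-reference by `2`, and rewire each header input wire `(u,v)` (`u, v < t`) to the constant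
`h (u,v)`; the automorphism extending `ρ` is `id ⊕ σ` (header wires are fixed by `ρ × ρ`, `ρ` permutes
non-header coordinates among themselves, and the argument-multiset condition is transported along
`rewire ∘ relabelWire ρ σ = relabelWire ρ (id ⊕ σ) ∘ rewire`). Folklore (Anderson–Dawar 2017 §2,
restrictions of symmetric circuits); unwritten for the tree's straight-line `Circuit` (M). -/
theorem stub_headerHardwiring :
    ∀ (m t s : ℕ) (Γ : Set (Equiv.Perm (Fin m))),
      (∀ ρ ∈ Γ, ∀ i : Fin m, (i : ℕ) < t → ρ i = i) →
      ∀ (f : (Fin m × Fin m → Bool) → Bool) (h : Fin m × Fin m → Bool),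
        HasSymCircuit tcBasis Γ s f →
        HasSymCircuit tcBasis Γ (s + 2)
          (fun x => f (fun q => if (q.1 : ℕ) < t ∧ (q.2 : ℕ) < t then h q else x q)) :=
  -- LANDED (wave 1, p74277): `Summits/PneNP/PneNP/Theorems/SymmetryBudgetWindowBarrierStubHeaderHardwiring.lean`
  _root_.Summit.PneNP.PneNP.Theorems.stub_headerHardwiring

/-- **S4 — symmetric indistinguishability in the window (the OPEN core; hardest stub).**
For every polynomial `p`, for infinitely many `m`, there are two `m × m` Boolean matrices `x, y` whose
graphs `Gr x`, `Gr y` are NOT `Bud(m,⌊log₂ m⌋)`-isomorphic and yet EVERY `Bud(m,⌊log₂ m⌋)`-symmetric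
`tcBasis`-circuit with at most `p(m)` gates takes the same value on `x` and on `y`.
This is the transfer target `C⁺` of the idea: strictly stronger than "the canonical-form language is
symmetric-hard" (a single pair must fool all small symmetric circuits at once — the form in which every
symmetric lower bound in print is actually proved: supports ⇒ counting width ⇒ C^k-equivalent CFI pairs),
but free of `P`, encodings and Turing machines, so that circuit-side invariants (the entropy/block
support theorem and block counting game of idea `entropy-support-dichotomy`) apply verbatim.
Why it might fail: `Bud`-symmetric circuits with orbits up to `2^{O(g)}` (one gate per SUBSET of the
free part) may separate every non-isomorphic pair even though no single small circuit computes a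
complete invariant; then this LINE dies while the crux may stand. Necessary features of a witness pair:
equal ordered × ordered blocks (size-0 input circuits), equal subset statistics of every bounded
"entropy", `(c·g/log g)`-WL-equivalent free parts. Sources: Dawar–Wilsenach ToC 2025 §6 (Thms 6.2–6.4),
Cai–Fürer–Immerman 1992, arXiv:1901.07825 Lemmas 13–14 (the technique that works only for `g = ω(log m)`),
TRIAGE-r1-1.md (attack (i)–(v)). -/
theorem stub_symmetricIndistinguishability :
    ∀ p : Polynomial ℕ, ∃ᶠ m in atTop, ∃ x y : Fin m × Fin m → Bool,
      (¬ ∃ ρ ∈ pointStabiliserBudget m (Nat.log 2 m),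
          (SimpleGraph.fromRel fun u v => x (ρ u, ρ v) = true) =
            (SimpleGraph.fromRel fun u v => y (u, v) = true)) ∧
      ∀ C : Circuit (Fin m × Fin m), C.IsOver tcBasis → C.size ≤ p.eval m →
        C.IsSymmetricUnder (pointStabiliserBudget m (Nat.log 2 m)) → C.eval x = C.eval y := by
  sorry

/-! ## Composition (no `sorry` below this line) -/

/-- A gate-free input circuit `x ↦ x q` is symmetric under any set of permutations fixing both
coordinates of `q`. [folklore] -/
theorem input_isSymmetricUnder {m : ℕ} (Γ : Set (Equiv.Perm (Fin m))) (q : Fin m × Fin m)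
    (hq : ∀ ρ ∈ Γ, ρ q.1 = q.1 ∧ ρ q.2 = q.2) :
    (Circuit.input q).IsSymmetricUnder Γ := by
  intro ρ hρ
  refine ⟨1, ?_, ?_⟩
  · show Sum.inl (ρ q.1, ρ q.2) = Sum.inl q
    rw [(hq ρ hρ).1, (hq ρ hρ).2]
  · intro j
    exact absurd j.2 (Nat.not_lt_zero _)

/-- **The composition `S1 → S2 → S3 → S4 → WindowBarrier`**, with the crux written over the landed
vocabulary (`HasSymCircuit tcBasis`, `pointStabiliserBudget`) — definitionally the route's inline
`HasSym`/`Bud` (`Circuit.isSymmetricUnder_iff` is `Iff.rfl`). Proof: `L` from S2 applied to the `F`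
of S1; given `p`, S4 at `p + 2` yields, frequently in `m` (and eventually `m ≥ m₁`), a fooling pair
`(x, y)`; it agrees on the header (input wires are symmetric circuits of size `0`), so S2 gives a header
`h` on which `L` separates the overwritten pair; a symmetric circuit of size `≤ p m` for the slice would,
by S3, give one of size `≤ p m + 2` for the overwritten slice, which the pair fools — contradiction. -/
theorem windowBarrier_restated
    (h₁ : ∃ F ∈ FP, ∃ m₀ : ℕ, ∀ m : ℕ, m₀ ≤ m → ∀ x y : Fin m × Fin m → Bool,
      (F (encodingGraph.encode ⟨m, SimpleGraph.fromRel fun u v => x (u, v) = true⟩) =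
          F (encodingGraph.encode ⟨m, SimpleGraph.fromRel fun u v => y (u, v) = true⟩) ↔
        ∃ ρ ∈ pointStabiliserBudget m (Nat.log 2 m),
          (SimpleGraph.fromRel fun u v => x (ρ u, ρ v) = true) =
            (SimpleGraph.fromRel fun u v => y (u, v) = true)))
    (h₂ : ∀ F ∈ FP, ∀ m₀ : ℕ,
      (∀ m : ℕ, m₀ ≤ m → ∀ x y : Fin m × Fin m → Bool,
        (F (encodingGraph.encode ⟨m, SimpleGraph.fromRel fun u v => x (u, v) = true⟩) =
            F (encodingGraph.encode ⟨m, SimpleGraph.fromRel fun u v => y (u, v) = true⟩) ↔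
          ∃ ρ ∈ pointStabiliserBudget m (Nat.log 2 m),
            (SimpleGraph.fromRel fun u v => x (ρ u, ρ v) = true) =
              (SimpleGraph.fromRel fun u v => y (u, v) = true))) →
      ∃ L ∈ Classes.P, ∃ t : ℕ → ℕ, ∃ m₁ : ℕ,
        (∀ m : ℕ, ∀ ρ ∈ pointStabiliserBudget m (Nat.log 2 m), ∀ x : Fin m × Fin m → Bool,
          encodingGraph.encode ⟨m, SimpleGraph.fromRel fun u v => x (ρ u, ρ v) = true⟩ ∈ L ↔
            encodingGraph.encode ⟨m, SimpleGraph.fromRel fun u v => x (u, v) = true⟩ ∈ L) ∧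
        (∀ m : ℕ, m₁ ≤ m → t m + Nat.log 2 m ≤ m) ∧
        (∀ m : ℕ, m₁ ≤ m → ∀ x y : Fin m × Fin m → Bool,
          (∀ q : Fin m × Fin m, (q.1 : ℕ) < t m → (q.2 : ℕ) < t m → x q = y q) →
          (¬ ∃ ρ ∈ pointStabiliserBudget m (Nat.log 2 m),
              (SimpleGraph.fromRel fun u v => x (ρ u, ρ v) = true) =
                (SimpleGraph.fromRel fun u v => y (u, v) = true)) →
          ∃ h : Fin m × Fin m → Bool,
            ¬ (encodingGraph.encode ⟨m, SimpleGraph.fromRel fun u v =>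
                    (if (u : ℕ) < t m ∧ (v : ℕ) < t m then h (u, v) else x (u, v)) = true⟩ ∈ L ↔
                encodingGraph.encode ⟨m, SimpleGraph.fromRel fun u v =>
                    (if (u : ℕ) < t m ∧ (v : ℕ) < t m then h (u, v) else y (u, v)) = true⟩ ∈ L)))
    (h₃ : ∀ (m t s : ℕ) (Γ : Set (Equiv.Perm (Fin m))),
      (∀ ρ ∈ Γ, ∀ i : Fin m, (i : ℕ) < t → ρ i = i) →
      ∀ (f : (Fin m × Fin m → Bool) → Bool) (h : Fin m × Fin m → Bool),
        HasSymCircuit tcBasis Γ s f →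
        HasSymCircuit tcBasis Γ (s + 2)
          (fun x => f (fun q => if (q.1 : ℕ) < t ∧ (q.2 : ℕ) < t then h q else x q)))
    (h₄ : ∀ p : Polynomial ℕ, ∃ᶠ m in atTop, ∃ x y : Fin m × Fin m → Bool,
      (¬ ∃ ρ ∈ pointStabiliserBudget m (Nat.log 2 m),
          (SimpleGraph.fromRel fun u v => x (ρ u, ρ v) = true) =
            (SimpleGraph.fromRel fun u v => y (u, v) = true)) ∧
      ∀ C : Circuit (Fin m × Fin m), C.IsOver tcBasis → C.size ≤ p.eval m →
        C.IsSymmetricUnder (pointStabiliserBudget m (Nat.log 2 m)) → C.eval x = C.eval y) :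
    ∃ L ∈ Classes.P,
      (∀ m : ℕ, ∀ ρ ∈ pointStabiliserBudget m (Nat.log 2 m), ∀ x : Fin m × Fin m → Bool,
        encodingGraph.encode ⟨m, SimpleGraph.fromRel fun u v => x (ρ u, ρ v) = true⟩ ∈ L ↔
          encodingGraph.encode ⟨m, SimpleGraph.fromRel fun u v => x (u, v) = true⟩ ∈ L) ∧
      ∀ p : Polynomial ℕ, ∃ᶠ m in atTop,
        ¬ HasSymCircuit tcBasis (pointStabiliserBudget m (Nat.log 2 m)) (p.eval m)
            (fun x : Fin m × Fin m → Bool =>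
              decide (encodingGraph.encode ⟨m, SimpleGraph.fromRel fun u v => x (u, v) = true⟩ ∈ L)) := by
  obtain ⟨F, hF, m₀, hcomp⟩ := h₁
  obtain ⟨L, hLP, t, m₁, hinv, hfit, hsep⟩ := h₂ F hF m₀ hcomp
  refine ⟨L, hLP, hinv, fun p => ?_⟩
  have hfool := h₄ (p + 2)
  refine (hfool.and_eventually (eventually_ge_atTop m₁)).mono ?_
  rintro m ⟨⟨x, y, hniso, hxy⟩, hm⟩ hsym
  -- `Bud` fixes the header pointwise
  have hfix : ∀ ρ ∈ pointStabiliserBudget m (Nat.log 2 m), ∀ i : Fin m, (i : ℕ) < t m → ρ i = i := by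
    intro ρ hρ i hi
    have hle := hfit m hm
    exact hρ i (by omega)
  -- the fooling pair agrees on the header block (input wires there are symmetric circuits of size 0)
  have hagree : ∀ q : Fin m × Fin m, (q.1 : ℕ) < t m → (q.2 : ℕ) < t m → x q = y q := by
    intro q hq₁ hq₂
    have hO : (Circuit.input q).IsOver tcBasis := by
      intro g hg
      simp [Circuit.input] at hg
    have hS : (Circuit.input q).IsSymmetricUnder (pointStabiliserBudget m (Nat.log 2 m)) :=
      input_isSymmetricUnder _ q fun ρ hρ => ⟨hfix ρ hρ q.1 hq₁, hfix ρ hρ q.2 hq₂⟩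
    have hsz : (Circuit.input q).size ≤ (p + 2).eval m := by
      rw [Circuit.size_input]
      exact Nat.zero_le _
    simpa using hxy (Circuit.input q) hO hsz hS
  obtain ⟨h, hh⟩ := hsep m hm x y hagree hniso
  obtain ⟨C, hCO, hCs, hCsym, hCcomp⟩ :=
    h₃ m (t m) (p.eval m) (pointStabiliserBudget m (Nat.log 2 m)) hfix _ h hsym
  apply hh
  have hsize : C.size ≤ (p + 2).eval m := by
    have : (p + 2 : Polynomial ℕ).eval m = p.eval m + 2 := by
      simp [Polynomial.eval_add]
    omega
  have hev := hxy C hCO hsize hCsym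
  rw [hCcomp x, hCcomp y] at hev
  exact decide_eq_decide.mp hev

/-- **Skeleton theorem**: the crux `SymmetryBudget.WindowBarrier`, concluded BY NAME from the four
stubs. The route decl is a `let Sym … HasSym … Bud … Gr …` prelude followed by the statement; those
lets are verbatim `Circuit.IsSymmetricUnder`, `HasSymCircuit tcBasis`, `pointStabiliserBudget` and
`SimpleGraph.fromRel fun u v => x (u, v) = true`, so `windowBarrier_restated` closes it by
definitional unfolding. -/
theorem WindowBarrier_of : Summit.PneNP.PneNP.Theses.SymmetryBudget.WindowBarrier := by
  have H := windowBarrier_restated completeInvariantFP stub_addressableBitLanguage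
    stub_headerHardwiring stub_symmetricIndistinguishability
  exact H

end Summit.PneNP.PneNP.Cruxes.WindowBarrier.CanonicalFormCompleteness
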